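import Mathlib
import Literature.Combinatorics.Additive.TripleProductProperty
import Literature.Barriers.MatrixMultiplication.QuasirandomBarrier
import Literature.Barriers.MatrixMultiplication.QuasirandomBarrierProofs
import Summits.MatrixMultiplication.MatrixMultiplication.Theses.SnSubsetDichotomy
import Summits.MatrixMultiplication.MatrixMultiplication.Theorems.SnSubsetDichotomyPolynomialSlackMinDegree

/-!
# `PolynomialSlack` (stmt-MatrixMultiplication-8306): the print regime `C < 1/2`, unconditionally

Helper file 3/3 of the PRINT REGIME of the crux `SnSubsetDichotomy.PolynomialSlack` (line
`transport-split-hull`, leads c1/c2). The crux asks, for EVERY real `C`, that eventually in `n` every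
triple `S, T, U ⊆ S_n` with the triple product property has `|S||T||U|·n^C ≤ (n!)^{3/2}`. In print the
regime `C < 1/2` is Blasiak–Cohn–Grochow–Pratt–Umans 2023, Thm. 3.2 (`|S||T||U| ≤ |G|^{3/2}/√n(G) + |G|`,
a tree THEOREM: `BCGPU2023_thm32_holds`) together with `n(S_n) = n - 1`; the tree had no lower bound for
`n(S_n)` until file 2/3 (`div_four_le_secondCharDegree_perm : n / 4 ≤ n(S_n)` for `n ≥ 5`). Here:

* `exists_mul_ne_perm` — `S_n` is non-abelian for `n ≥ 3`;
* `tpp_volume_le_perm` — the EXPLICIT form `|S||T||U| ≤ (n!)^{3/2}/√⌊n/4⌋ + n!` for every TPP triple of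
  subsets of `S_n`, `n ≥ 5` (no asymptotics; usable by small-`n` census work);
* `polynomialSlack_of_lt_half` — for every `C < 1/2` there is `n₀` with `|S||T||U|·n^C ≤ (n!)^{3/2}` for
  all TPP triples in `S_n`, `n ≥ n₀`: the matrix of `PolynomialSlack` at every exponent below `1/2`.

So the open content of the crux is exactly the half-line `C ≥ 1/2`.
-/

namespace Summit.MatrixMultiplication.MatrixMultiplication.Theorems.PolynomialSlack

open Literature.Combinatorics.Additive Literature.Barriers.MatrixMultiplication

-- `Summit.<Summit>.<Problem>` is the tree's mandated summit-side namespace (CONVENTIONS §2); for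
-- this single-conjunct summit the two coincide, so each declaration silences `dupNamespace`.
set_option linter.dupNamespace false

/-- `S_n` is non-abelian for `n ≥ 3`: the transpositions `(0 1)` and `(1 2)` do not commute. [folklore] -/
theorem exists_mul_ne_perm {n : ℕ} (hn : 3 ≤ n) :
    ∃ a b : Equiv.Perm (Fin n), a * b ≠ b * a := by
  refine ⟨Equiv.swap ⟨0, by omega⟩ ⟨1, by omega⟩, Equiv.swap ⟨1, by omega⟩ ⟨2, by omega⟩, ?_⟩
  intro h
  have := congrArg (fun π : Equiv.Perm (Fin n) => (π ⟨0, by omega⟩ : Fin n).val) h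
  simp [Equiv.swap_apply_def, Fin.ext_iff] at this

/-- **BCGPU 2023 Thm. 3.2 in `S_n`, explicit form.** For `n ≥ 5` and every triple of subsets of `S_n`
with the triple product property, `|S||T||U| ≤ (n!)^{3/2}/√⌊n/4⌋ + n!` — Thm. 3.2 (tree theorem
`BCGPU2023_thm32_holds`) with `|S_n| = n!` and the tree's lower bound `⌊n/4⌋ ≤ n(S_n)`
(`div_four_le_secondCharDegree_perm`). [cite: BlasiakCohnGrochowPrattUmans2023, Thm. 3.2] -/
theorem tpp_volume_le_perm {n : ℕ} (hn : 5 ≤ n) (S T U : Finset (Equiv.Perm (Fin n)))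
    (hTPP : TripleProductProperty S T U) :
    ((S.card * T.card * U.card : ℕ) : ℝ) ≤
      (n.factorial : ℝ) ^ (3 / 2 : ℝ) / Real.sqrt ((n / 4 : ℕ) : ℝ) + n.factorial := by
  have h32 := BCGPU2023_thm32_holds (Equiv.Perm (Fin n)) (exists_mul_ne_perm (by omega)) S T U hTPP
  rw [Fintype.card_perm, Fintype.card_fin] at h32
  have hd : ((n / 4 : ℕ) : ℝ) ≤ (secondCharDegree (Equiv.Perm (Fin n)) : ℝ) := by
    exact_mod_cast div_four_le_secondCharDegree_perm hn
  have hd0 : (0 : ℝ) < ((n / 4 : ℕ) : ℝ) := by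
    have : 1 ≤ n / 4 := by omega
    exact_mod_cast this
  refine h32.trans (add_le_add ?_ le_rfl)
  have hF : (0 : ℝ) ≤ (n.factorial : ℝ) ^ (3 / 2 : ℝ) := by positivity
  exact div_le_div_of_nonneg_left hF (Real.sqrt_pos.2 hd0) (Real.sqrt_le_sqrt hd)

/-- **The print regime of `PolynomialSlack`: every exponent `C < 1/2`, unconditionally.** For `C < 1/2`
there is `n₀` such that `|S||T||U|·n^C ≤ (n!)^{3/2}` for all `n ≥ n₀` and all TPP triples
`S, T, U ⊆ S_n`. From `tpp_volume_le_perm`: `|S||T||U|·n^C ≤ (n!)^{3/2}·(n^C/√⌊n/4⌋) + n!·n^C`, and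
for `n ≥ max(8, 32^{1/(1-2C)})` both `n^C/√⌊n/4⌋ ≤ 1/2` (as `8⌊n/4⌋ ≥ n ≥ 32·n^{2C}`) and
`n^C ≤ √(n!)/2` (as `4n^{2C} ≤ 4n ≤ n!`). [cite: BlasiakCohnGrochowPrattUmans2023, Thm. 3.2] -/
theorem polynomialSlack_of_lt_half (C : ℝ) (hC : C < 1 / 2) :
    ∃ n₀ : ℕ, ∀ n ≥ n₀, ∀ S T U : Finset (Equiv.Perm (Fin n)), TripleProductProperty S T U →
      ((S.card * T.card * U.card : ℕ) : ℝ) * (n : ℝ) ^ C ≤ (n.factorial : ℝ) ^ ((3 : ℝ) / 2) := by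
  -- the threshold
  have hε : 0 < 1 - 2 * C := by linarith
  obtain ⟨N, hN⟩ := exists_nat_ge ((32 : ℝ) ^ (1 / (1 - 2 * C)))
  refine ⟨max N 8, fun n hn S T U hTPP => ?_⟩
  have hNn : N ≤ n := (le_max_left _ _).trans hn
  have hn8 : 8 ≤ n := (le_max_right _ _).trans hn
  have hn8R : (8 : ℝ) ≤ n := by exact_mod_cast hn8
  have hn0 : (0 : ℝ) < n := by linarith
  have hn1 : (1 : ℝ) ≤ n := by linarith
  -- notation
  set F : ℝ := (n.factorial : ℝ) with hF
  set s : ℝ := Real.sqrt F with hs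
  set P : ℝ := ((S.card * T.card * U.card : ℕ) : ℝ) with hP
  set d : ℝ := ((n / 4 : ℕ) : ℝ) with hd
  have hF0 : 0 < F := by rw [hF]; exact_mod_cast n.factorial_pos
  have hs0 : 0 < s := Real.sqrt_pos.2 hF0
  have hP0 : 0 ≤ P := by rw [hP]; exact Nat.cast_nonneg _
  have hnC0 : 0 ≤ (n : ℝ) ^ C := Real.rpow_nonneg hn0.le C
  have hrpow : F ^ ((3 : ℝ) / 2) = F * s := by
    rw [show (3 : ℝ) / 2 = 1 + 1 / 2 by norm_num, Real.rpow_add hF0, Real.rpow_one, hs,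
      Real.sqrt_eq_rpow]
  -- `8 d ≥ n` and `d > 0`
  have hd8 : (n : ℝ) ≤ 8 * d := by
    have h1 : n ≤ 8 * (n / 4) := by omega
    rw [hd]; exact_mod_cast h1
  have hd0 : 0 < d := by linarith
  -- (i) `n^C / √d ≤ 1/2`, from `32 n^{2C} ≤ n ≤ 8 d`
  have h32 : (32 : ℝ) ≤ (n : ℝ) ^ (1 - 2 * C) := by
    have hNR : (32 : ℝ) ^ (1 / (1 - 2 * C)) ≤ n := hN.trans (by exact_mod_cast hNn)
    have h := Real.rpow_le_rpow (by positivity) hNR hε.le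
    rwa [← Real.rpow_mul (by norm_num : (0 : ℝ) ≤ 32), one_div, inv_mul_cancel₀ hε.ne',
      Real.rpow_one] at h
  have hi : (n : ℝ) ^ C / Real.sqrt d ≤ 1 / 2 := by
    rw [div_le_iff₀ (Real.sqrt_pos.2 hd0)]
    -- `n^C ≤ √d / 2 ⟸ 4 n^{2C} ≤ d`
    have h4 : 4 * ((n : ℝ) ^ C) ^ 2 ≤ d := by
      have e : ((n : ℝ) ^ C) ^ 2 * (n : ℝ) ^ (1 - 2 * C) = n := by
        rw [← Real.rpow_natCast, ← Real.rpow_mul hn0.le, ← Real.rpow_add hn0]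
        have h1 : C * ((2 : ℕ) : ℝ) + (1 - 2 * C) = 1 := by push_cast; ring
        rw [h1, Real.rpow_one]
      nlinarith [mul_le_mul_of_nonneg_left h32 (sq_nonneg ((n : ℝ) ^ C)), hd8]
    have hsq : (2 * (n : ℝ) ^ C) ^ 2 ≤ d := by nlinarith
    have h2 : 2 * (n : ℝ) ^ C ≤ Real.sqrt d := Real.le_sqrt_of_sq_le hsq
    linarith
  -- (ii) `n^C ≤ s / 2`, from `4 n^{2C} ≤ 4 n ≤ n!`
  have hii : (n : ℝ) ^ C ≤ s / 2 := by
    have hC1 : (n : ℝ) ^ C ≤ (n : ℝ) ^ (1 / 2 : ℝ) :=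
      Real.rpow_le_rpow_of_exponent_le hn1 (by linarith)
    have h4n : 4 * (n : ℝ) ≤ F := by
      have h : 4 * n ≤ n.factorial := by
        have h6 : 6 ≤ (n - 1).factorial :=
          (Nat.factorial_le (show 3 ≤ n - 1 by omega)).trans' (by decide)
        have e : n.factorial = n * (n - 1).factorial := by
          conv_lhs => rw [show n = (n - 1) + 1 by omega, Nat.factorial_succ]
          rw [show n - 1 + 1 = n by omega]
        rw [e]; nlinarith
      rw [hF]; exact_mod_cast h
    have hsq : (2 * (n : ℝ) ^ (1 / 2 : ℝ)) ^ 2 ≤ F := by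
      rw [mul_pow, ← Real.sqrt_eq_rpow (n : ℝ), Real.sq_sqrt hn0.le]
      linarith
    have h2 : 2 * (n : ℝ) ^ (1 / 2 : ℝ) ≤ s := Real.le_sqrt_of_sq_le hsq
    linarith
  -- assemble
  have hvol : P ≤ F ^ (3 / 2 : ℝ) / Real.sqrt d + F := tpp_volume_le_perm (by omega) S T U hTPP
  rw [hrpow] at hvol
  rw [hrpow]
  calc P * (n : ℝ) ^ C ≤ (F * s / Real.sqrt d + F) * (n : ℝ) ^ C :=
        mul_le_mul_of_nonneg_right hvol hnC0
    _ = F * s * ((n : ℝ) ^ C / Real.sqrt d) + F * (n : ℝ) ^ C := by ring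
    _ ≤ F * s * (1 / 2) + F * (s / 2) := by
        gcongr
    _ = F * s := by ring

end Summit.MatrixMultiplication.MatrixMultiplication.Theorems.PolynomialSlack
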